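import Summits.CriticalPhenomena.PercolationContinuityZ3.Theorems.PercNearOneGluingAdditiveGluingClusterPeelLoc
import HarnessLib

/-! # Crux `PercNearOneGluing.AdditiveGluing` (stmt-CriticalPhenomena-4576) — GRADED form of the AG-loc peeling reduction:
# (LOC-peel) for `3 ≤ |A| ≤ K`  ⇒  AG-loc and `AdditiveGluing` for `|A| ≤ K`

Support file (`--supports stmt-CriticalPhenomena-4576`, cell `prim-png-dp-al5` gen 5).  No definitions, no named facts, no sorries.  Companion of
`…ClusterPeelLoc.lean` (`agloc_firstRank_of_locPeel`: the kernel for ALL `|A| ≥ 3` gives AG-loc for all `A`).  Here the size bound is threaded through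
the same induction, so that a proof of the kernel for SMALL relay sets already pays: with `K = 3`, the single 5-point inequality (LOC-peel)(3) — peel one
relay `d` of `A = {d, a, c}`, bound the residual failure of `G − C(d)` by the PROVED two-relay AG-loc — yields AG-loc(3), Kozma–Nitzan's Conjecture 1 for
three relays and the three-relay case of the crux (`additiveGluing_card_of_locPeel 3`), the case singled out as open by the lead (LeadMath-g4 §2).
Kernel, notation and evidence: see `…ClusterPeelLoc.lean` and the seat memo LOCPEEL-g5.md (item evidence on stmt-CriticalPhenomena-4576).
[cite: KozmaNitzan2024, Conj. 1 (p. 3), §3.2 p. 12 (conditioning on C(0) = W), Thm. 1 pp. 7–8]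
-/

namespace Summit.CriticalPhenomena.PercolationContinuityZ3.Theorems

open MeasureTheory Set
open Literature.Probability.LatticeModels (prodBernoulli)
open Literature.Probability.Percolation
open scoped BigOperators

noncomputable section
open Classical

namespace ClusterPeelLocCard

open ClusterPeel ClusterPeelLoc

/-- **Graded form: (LOC-peel) for `3 ≤ |A| ≤ K` ⇒ (AG-loc) for `|A| ≤ K`.**  In particular the single inequality (LOC-peel) for `|A| = 3`
(whose residual instances have `≤ 2` relays, where AG-loc is proved) gives AG-loc — hence `AdditiveGluing` — for three relays.
Same proof as `ClusterPeelLoc.agloc_firstRank_of_locPeel`, with the size bound threaded through the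
strong induction on `|A|`: `|A| ≤ 2` is `AGloc.agloc_firstRank_card_le_two`; `o = b` is empty; `o ∈ A`: every pattern's first relay is at most as
reliable as `o`; `b ∈ A`: the instance equals the one on `A ∖ b` term by term; otherwise peel the relay `d` of the kernel (`ClusterPeel.peel_bound`
with the induction hypothesis on the residual instance `restrW Wᶜ w`, rank `r_W`). [cite: KozmaNitzan2024, Conj. 1 (p. 3), §3.2 p. 12] -/
theorem agloc_firstRank_card_of_locPeel (K : ℕ)
    (hL : ∀ (n : ℕ) (w : Sym2 (Fin n) → unitInterval) (A : Finset (Fin n)) (o b : Fin n) (r : Fin n → ℕ),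
      o ∉ A → b ∉ A → o ≠ b → 3 ≤ A.card → A.card ≤ K → Set.InjOn r ↑A →
      (∀ a ∈ A, ∀ a' ∈ A, r a < r a' → (prodBernoulli w).real (openConn a b) ≤ (prodBernoulli w).real (openConn a' b)) →
      ∃ d ∈ A, ∃ rW : Finset (Fin n) → (Fin n → ℕ),
        (∀ W : Finset (Fin n), Set.InjOn (rW W) ↑(A \ W)) ∧
        (∀ W : Finset (Fin n), ∀ a ∈ A \ W, ∀ a' ∈ A \ W, rW W a < rW W a' →
          (prodBernoulli w).real (openConnIn ((↑W : Set (Fin n))ᶜ) a b) ≤ (prodBernoulli w).real (openConnIn ((↑W : Set (Fin n))ᶜ) a' b)) ∧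
        (prodBernoulli w).real (openConn d o ∩ (openConn d b)ᶜ : Set (BondConfig (Fin n)))
          + (prodBernoulli w).real (openConn d b ∩ (openConn d o)ᶜ ∩ (⋃ a ∈ A.erase d, openConn o a))
          + ∑ W ∈ Finset.univ.filter (fun W : Finset (Fin n) => o ∉ W ∧ b ∉ W),
              (prodBernoulli w).real (clusterIs d W) *
                ∑ a ∈ A \ W, (prodBernoulli w).real
                    (openConnIn ((↑W : Set (Fin n))ᶜ) o a ∩
                      ⋂ a' ∈ (A \ W).filter (fun a' => rW W a' < rW W a), (openConnIn ((↑W : Set (Fin n))ᶜ) o a')ᶜ) *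
                  (1 - (prodBernoulli w).real (openConnIn ((↑W : Set (Fin n))ᶜ) a b))
        ≤ ∑ a ∈ A, (prodBernoulli w).real
              (openConn o a ∩ ⋂ a' ∈ A.filter (fun a' => r a' < r a), (openConn o a')ᶜ : Set (BondConfig (Fin n))) *
            (1 - (prodBernoulli w).real (openConn a b)))
    (n : ℕ) :
    ∀ (K' : ℕ), K' ≤ K → ∀ (w : Sym2 (Fin n) → unitInterval) (A : Finset (Fin n)) (o b : Fin n) (r : Fin n → ℕ),
      A.card ≤ K' → Set.InjOn r ↑A →
      (∀ a ∈ A, ∀ a' ∈ A, r a < r a' → (prodBernoulli w).real (openConn a b) ≤ (prodBernoulli w).real (openConn a' b)) →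
      (prodBernoulli w).real ((⋃ a ∈ A, openConn o a) ∩ (openConn o b)ᶜ : Set (BondConfig (Fin n))) ≤
        ∑ a ∈ A, (prodBernoulli w).real
            (openConn o a ∩ ⋂ a' ∈ A.filter (fun a' => r a' < r a), (openConn o a')ᶜ : Set (BondConfig (Fin n))) *
          (1 - (prodBernoulli w).real (openConn a b)) := by
  intro K'
  induction K' with
  | zero =>
    intro _ w A o b r hA hr hc
    exact AGloc.agloc_firstRank_card_le_two w A o b r (by omega) hr hc
  | succ K' ih' =>
    intro hK w A o b r hA hr hc
    have ih := ih' (by omega)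
    set μ := prodBernoulli w with hμ
    have hmeas : ∀ E : Set (BondConfig (Fin n)), MeasurableSet E := fun E => MeasurableSet.of_discrete
    -- abbreviation for the patterns
    set P : Fin n → Set (BondConfig (Fin n)) := fun a =>
      (openConn o a ∩ ⋂ a' ∈ A.filter (fun a' => r a' < r a), (openConn o a')ᶜ : Set (BondConfig (Fin n))) with hP
    have hRHS_nonneg : ∀ a ∈ A, 0 ≤ μ.real (P a) * (1 - μ.real (openConn a b)) := fun a _ =>
      mul_nonneg measureReal_nonneg (by linarith [measureReal_le_one (μ := μ) (s := (openConn a b : Set (BondConfig (Fin n))))])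
    by_cases hA2 : A.card ≤ 2
    · exact AGloc.agloc_firstRank_card_le_two w A o b r hA2 hr hc
    by_cases hob : o = b
    · subst hob
      have : ((⋃ a ∈ A, openConn o a) ∩ (openConn o o)ᶜ : Set (BondConfig (Fin n))) = ∅ := by
        ext ω
        simp only [mem_inter_iff, mem_compl_iff, mem_empty_iff_false, iff_false, not_and, not_not]
        exact fun _ => SimpleGraph.Reachable.refl o
      rw [this, measureReal_empty]
      exact Finset.sum_nonneg hRHS_nonneg
    by_cases ho : o ∈ A
    · -- failure ⊆ {o ↮ b}; every pattern's first relay `a` has `r a ≤ r o`, hence `τ_a ≤ τ_o`, or the pattern is empty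
      have hfail : μ.real ((⋃ a ∈ A, openConn o a) ∩ (openConn o b)ᶜ : Set (BondConfig (Fin n))) ≤ 1 - μ.real (openConn o b) := by
        calc μ.real ((⋃ a ∈ A, openConn o a) ∩ (openConn o b)ᶜ : Set (BondConfig (Fin n)))
            ≤ μ.real ((openConn o b)ᶜ : Set (BondConfig (Fin n))) := measureReal_mono inter_subset_right
          _ = 1 - μ.real (openConn o b) := probReal_compl_eq_one_sub (hmeas _)
      have hterm : ∀ a ∈ A, μ.real (P a) * (1 - μ.real (openConn o b)) ≤ μ.real (P a) * (1 - μ.real (openConn a b)) := by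
        intro a ha
        by_cases hlt : r o < r a
        · have hPa : P a = ∅ := by
            ext ω
            simp only [hP, mem_inter_iff, mem_iInter, mem_compl_iff, mem_empty_iff_false, iff_false, not_and, not_forall,
              not_not]
            intro _
            exact ⟨o, Finset.mem_filter.2 ⟨ho, hlt⟩, SimpleGraph.Reachable.refl o⟩
          rw [hPa, measureReal_empty, zero_mul, zero_mul]
        · have hτ : μ.real (openConn a b) ≤ μ.real (openConn o b) := by
            by_cases hao : a = o
            · rw [hao]
            · exact hc a ha o ho (lt_of_le_of_ne (not_lt.1 hlt) fun h => hao (hr ha ho h))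
          exact mul_le_mul_of_nonneg_left (by linarith) measureReal_nonneg
      have hsum : ∑ a ∈ A, μ.real (P a) = 1 := by
        rw [hP, AGloc.sum_measureReal_firstRank w A r o hr]
        apply le_antisymm measureReal_le_one
        have hsub : (openConn o o : Set (BondConfig (Fin n))) ⊆ ⋃ a ∈ A, openConn o a := fun ω hω => mem_biUnion ho hω
        calc (1 : ℝ) = μ.real (openConn o o : Set (BondConfig (Fin n))) := by
              rw [show (openConn o o : Set (BondConfig (Fin n))) = univ from
                eq_univ_of_forall fun ω => SimpleGraph.Reachable.refl o, probReal_univ]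
          _ ≤ μ.real (⋃ a ∈ A, openConn o a) := measureReal_mono hsub (measure_ne_top _ _)
      calc μ.real ((⋃ a ∈ A, openConn o a) ∩ (openConn o b)ᶜ : Set (BondConfig (Fin n)))
          ≤ (∑ a ∈ A, μ.real (P a)) * (1 - μ.real (openConn o b)) := by rw [hsum, one_mul]; exact hfail
        _ = ∑ a ∈ A, μ.real (P a) * (1 - μ.real (openConn o b)) := Finset.sum_mul _ _ _
        _ ≤ ∑ a ∈ A, μ.real (P a) * (1 - μ.real (openConn a b)) := Finset.sum_le_sum hterm
    by_cases hb : b ∈ A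
    · -- reduce to A.erase b: the failure event and every term are the same
      set A' := A.erase b with hA'
      have hcard : A'.card ≤ K' := by rw [hA', Finset.card_erase_of_mem hb]; omega
      have hr' : Set.InjOn r ↑A' := hr.mono (by rw [hA']; exact Finset.coe_subset.2 (Finset.erase_subset b A))
      have hc' : ∀ a ∈ A', ∀ a' ∈ A', r a < r a' → μ.real (openConn a b) ≤ μ.real (openConn a' b) :=
        fun a ha a' ha' h => hc a (Finset.mem_of_mem_erase ha) a' (Finset.mem_of_mem_erase ha') h
      have hIH := ih w A' o b r hcard hr' hc'
      have hfail : ((⋃ a ∈ A, openConn o a) ∩ (openConn o b)ᶜ : Set (BondConfig (Fin n))) =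
          (⋃ a ∈ A', openConn o a) ∩ (openConn o b)ᶜ := by
        ext ω
        simp only [mem_inter_iff, mem_iUnion, mem_compl_iff, exists_prop]
        constructor
        · rintro ⟨⟨a, haA, hoa⟩, hnob⟩
          refine ⟨⟨a, Finset.mem_erase.2 ⟨?_, haA⟩, hoa⟩, hnob⟩
          rintro rfl; exact hnob hoa
        · rintro ⟨⟨a, haA, hoa⟩, hnob⟩
          exact ⟨⟨a, Finset.mem_of_mem_erase haA, hoa⟩, hnob⟩
      have hτb : μ.real (openConn b b : Set (BondConfig (Fin n))) = 1 := by
        rw [show (openConn b b : Set (BondConfig (Fin n))) = univ from eq_univ_of_forall fun ω => SimpleGraph.Reachable.refl b,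
          probReal_univ]
      -- termwise comparison
      have hterm : ∀ a ∈ A', μ.real (openConn o a ∩ ⋂ a' ∈ A'.filter (fun a' => r a' < r a), (openConn o a')ᶜ : Set (BondConfig (Fin n))) *
            (1 - μ.real (openConn a b)) = μ.real (P a) * (1 - μ.real (openConn a b)) := by
        intro a ha
        have haA : a ∈ A := Finset.mem_of_mem_erase ha
        have hab : a ≠ b := Finset.ne_of_mem_erase ha
        by_cases hlt : r b < r a
        · -- then τ_b ≤ τ_a forces τ_a = 1
          have h1 : μ.real (openConn a b) = 1 :=
            le_antisymm measureReal_le_one (by have := hc b hb a haA hlt; rw [hτb] at this; exact this)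
          rw [h1, sub_self, mul_zero, mul_zero]
        · congr 2
          rw [hP]
          congr 1
          have : A.filter (fun a' => r a' < r a) = A'.filter (fun a' => r a' < r a) := by
            ext x
            simp only [Finset.mem_filter, hA', Finset.mem_erase]
            constructor
            · rintro ⟨hx, hlt'⟩
              refine ⟨⟨?_, hx⟩, hlt'⟩
              rintro rfl; exact hlt hlt'
            · rintro ⟨⟨_, hx⟩, hlt'⟩; exact ⟨hx, hlt'⟩
          rw [this]
      calc μ.real ((⋃ a ∈ A, openConn o a) ∩ (openConn o b)ᶜ : Set (BondConfig (Fin n)))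
          = μ.real ((⋃ a ∈ A', openConn o a) ∩ (openConn o b)ᶜ : Set (BondConfig (Fin n))) := by rw [hfail]
        _ ≤ ∑ a ∈ A', μ.real (openConn o a ∩ ⋂ a' ∈ A'.filter (fun a' => r a' < r a), (openConn o a')ᶜ : Set (BondConfig (Fin n))) *
              (1 - μ.real (openConn a b)) := hIH
        _ = ∑ a ∈ A', μ.real (P a) * (1 - μ.real (openConn a b)) := Finset.sum_congr rfl hterm
        _ ≤ ∑ a ∈ A, μ.real (P a) * (1 - μ.real (openConn a b)) := by
            rw [hA']
            exact Finset.sum_le_sum_of_subset_of_nonneg (Finset.erase_subset b A) fun a ha _ => hRHS_nonneg a ha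
    -- main case: peel the relay of the kernel
    have hA3 : 3 ≤ A.card := by omega
    obtain ⟨d, hdA, rW, hrW, hcW, hker⟩ := hL n w A o b r ho hb hob hA3 (by omega) hr hc
    set Wc : Finset (Fin n) → Set (Fin n) := fun W => ((↑W : Set (Fin n))ᶜ) with hWc
    set β : Finset (Fin n) → ℝ := fun W =>
      ∑ a ∈ A \ W, μ.real (openConnIn (Wc W) o a ∩ ⋂ a' ∈ (A \ W).filter (fun a' => rW W a' < rW W a), (openConnIn (Wc W) o a')ᶜ) *
        (1 - μ.real (openConnIn (Wc W) a b)) with hβdef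
    have hβ : ∀ W : Finset (Fin n), o ∉ W → b ∉ W → d ∈ W →
        μ.real ((⋃ a ∈ A \ W, openConnIn (Wc W) o a) ∩ (openConnIn (Wc W) o b)ᶜ) ≤ β W := by
      intro W hoW hbW hdW
      have hcard : (A \ W).card ≤ K' := by
        have : (A \ W).card < A.card := Finset.card_lt_card ⟨Finset.sdiff_subset, fun h => (Finset.mem_sdiff.1 (h hdA)).2 hdW⟩
        omega
      have hcomp : ∀ a ∈ A \ W, ∀ a' ∈ A \ W, rW W a < rW W a' →
          (prodBernoulli (restrW (Wc W) w)).real (openConn a b) ≤ (prodBernoulli (restrW (Wc W) w)).real (openConn a' b) := by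
        intro a ha a' ha' h
        rw [hWc, restr_real_openConn w W (Finset.mem_sdiff.1 ha).2 b, restr_real_openConn w W (Finset.mem_sdiff.1 ha').2 b]
        exact hcW W a ha a' ha' h
      have hres := ih (restrW (Wc W) w) (A \ W) o b (rW W) hcard (hrW W) hcomp
      rw [hWc, restr_real_fail w W (A \ W) hoW b] at hres
      refine hres.trans (le_of_eq ?_)
      refine Finset.sum_congr rfl fun a ha => ?_
      rw [restr_real_firstPat w W _ hoW a, restr_real_openConn w W (Finset.mem_sdiff.1 ha).2 b]
    have hpeel := peel_bound w A o b d β hβ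
    have hsplit : ∑ W ∈ Finset.univ.filter (fun W : Finset (Fin n) => o ∉ W ∧ b ∉ W), μ.real (clusterIs d W) * (1 - β W) =
        μ.real ((openConn d o)ᶜ ∩ (openConn d b)ᶜ : Set (BondConfig (Fin n)))
          - ∑ W ∈ Finset.univ.filter (fun W : Finset (Fin n) => o ∉ W ∧ b ∉ W), μ.real (clusterIs d W) * β W := by
      rw [← sum_clusterIs_filter_eq w o b d, ← Finset.sum_sub_distrib]
      refine Finset.sum_congr rfl fun W _ => ?_
      ring
    have hdb : 1 - μ.real (openConn d b) =
        μ.real (openConn d o ∩ (openConn d b)ᶜ : Set (BondConfig (Fin n))) + μ.real ((openConn d o)ᶜ ∩ (openConn d b)ᶜ : Set (BondConfig (Fin n))) := by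
      rw [← probReal_compl_eq_one_sub (hmeas _), ← measureReal_union (μ := μ) _ (hmeas _)]
      · congr 1
        ext ω
        simp only [mem_compl_iff, mem_union, mem_inter_iff]
        tauto
      · exact Set.disjoint_left.2 fun ω h1 h2 => h2.1 h1.1
    rw [hsplit] at hpeel
    have hkey : μ.real ((⋃ a ∈ A, openConn o a) ∩ (openConn o b)ᶜ) ≤
        μ.real (openConn d o ∩ (openConn d b)ᶜ : Set (BondConfig (Fin n)))
          + μ.real (openConn d b ∩ (openConn d o)ᶜ ∩ (⋃ a ∈ A.erase d, openConn o a))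
          + ∑ W ∈ Finset.univ.filter (fun W : Finset (Fin n) => o ∉ W ∧ b ∉ W), μ.real (clusterIs d W) * β W := by
      linarith
    exact hkey.trans hker

/-- **Graded crux: (LOC-peel) for `3 ≤ |A| ≤ K` ⇒ `AdditiveGluing` for every relay set with `|A| ≤ K`** (via the lead's graded reduction
`AGloc.additiveGluing_card_of_agloc_firstRank`).  With `K = 3`: the three-relay case of the crux follows from the `|A| = 3` peeling inequality alone.
[cite: KozmaNitzan2024, Conj. 1 (p. 3), §3.2 p. 12] -/
theorem additiveGluing_card_of_locPeel (K : ℕ)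
    (hL : ∀ (n : ℕ) (w : Sym2 (Fin n) → unitInterval) (A : Finset (Fin n)) (o b : Fin n) (r : Fin n → ℕ),
      o ∉ A → b ∉ A → o ≠ b → 3 ≤ A.card → A.card ≤ K → Set.InjOn r ↑A →
      (∀ a ∈ A, ∀ a' ∈ A, r a < r a' → (prodBernoulli w).real (openConn a b) ≤ (prodBernoulli w).real (openConn a' b)) →
      ∃ d ∈ A, ∃ rW : Finset (Fin n) → (Fin n → ℕ),
        (∀ W : Finset (Fin n), Set.InjOn (rW W) ↑(A \ W)) ∧
        (∀ W : Finset (Fin n), ∀ a ∈ A \ W, ∀ a' ∈ A \ W, rW W a < rW W a' →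
          (prodBernoulli w).real (openConnIn ((↑W : Set (Fin n))ᶜ) a b) ≤ (prodBernoulli w).real (openConnIn ((↑W : Set (Fin n))ᶜ) a' b)) ∧
        (prodBernoulli w).real (openConn d o ∩ (openConn d b)ᶜ : Set (BondConfig (Fin n)))
          + (prodBernoulli w).real (openConn d b ∩ (openConn d o)ᶜ ∩ (⋃ a ∈ A.erase d, openConn o a))
          + ∑ W ∈ Finset.univ.filter (fun W : Finset (Fin n) => o ∉ W ∧ b ∉ W),
              (prodBernoulli w).real (clusterIs d W) *
                ∑ a ∈ A \ W, (prodBernoulli w).real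
                    (openConnIn ((↑W : Set (Fin n))ᶜ) o a ∩
                      ⋂ a' ∈ (A \ W).filter (fun a' => rW W a' < rW W a), (openConnIn ((↑W : Set (Fin n))ᶜ) o a')ᶜ) *
                  (1 - (prodBernoulli w).real (openConnIn ((↑W : Set (Fin n))ᶜ) a b))
        ≤ ∑ a ∈ A, (prodBernoulli w).real
              (openConn o a ∩ ⋂ a' ∈ A.filter (fun a' => r a' < r a), (openConn o a')ᶜ : Set (BondConfig (Fin n))) *
            (1 - (prodBernoulli w).real (openConn a b))) :
    ∀ (n : ℕ) (w : Sym2 (Fin n) → unitInterval) (A : Finset (Fin n)) (o b : Fin n) (t : ℝ), A.card ≤ K → 0 ≤ t →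
      (∀ a ∈ A, 1 - t ≤ (prodBernoulli w).real (openConn a b)) →
      (prodBernoulli w).real (⋃ a ∈ A, openConn o a) - t ≤ (prodBernoulli w).real (openConn o b) :=
  AGloc.additiveGluing_card_of_agloc_firstRank K fun n w A o b r hA hr hc =>
    agloc_firstRank_card_of_locPeel K hL n A.card hA w A o b r le_rfl hr hc

end ClusterPeelLocCard

end

end Summit.CriticalPhenomena.PercolationContinuityZ3.Theorems
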